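import Literature.MathematicalPhysics.QuantumFieldTheory.WilsonSiteRPForm
import Literature.MathematicalPhysics.QuantumFieldTheory.ConstructiveQFTWave0WilsonLoopRPProofs
import Literature.MathematicalPhysics.QuantumFieldTheory.LatticeGaugeStaticPotentialProofs
import HarnessLib

/-!
# Tomboulis–Yaffe reflection-positivity bounds: Wilson loops against Polyakov-loop correlators

E. T. Tomboulis and L. G. Yaffe, *Finite temperature SU(2) lattice gauge theory*, Comm. Math. Phys.
**100** (1985) 313–341, Appendix I ("Confinement criteria inequalities"), derive from reflection
positivity in lattice hyperplanes a chain of inequalities between rectangular Wilson loops, the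
two-point function of Polyakov loops ("traces of the twist `Ω[x]`", the closed straight lines
winding once around the periodic lattice) and the electric-flux free energy. This file proves the
first links of that chain for Wilson's lattice gauge theory on the even torus `(ℤ/Lℤ)^d`
(compact gauge group `G`, continuous matrix representation `ρ`, ANY real `β`; the tree's site
reflection `Θ'`, `t ↦ -t`, in the hyperplanes `t = 0`, `t = L/2`, and the Osterwalder–Schrader form
`WilsonSiteRP.siteRPForm` with its Cauchy–Schwarz inequality `WilsonSiteRP.normSq_siteRPForm_le`):

* `wilsonLoop_sq_le_double` — **doubling** (TY (A1.3): `W_{1,1} ≤ W_{1,2}^{1/2}`, "applying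
  reflection positivity to the loop with the plane of reflection perpendicular to the plane of the
  loop and containing one of its sides", and its iterates): for the `h × w` rectangle with `h ≤ L/2`
  steps in the time direction `0` and `w` steps in a spatial direction `j`,
  `⟨W_{h×w}⟩² ≤ ⟨W_{2h×w}⟩` and `0 ≤ ⟨W_{2h×w}⟩`.
* `wilsonLoop_half_sq_le_polyakovCorrelator` — **removing the legs lying in the reflection planes**
  (TY (A1.6): for the loop of time extent `L_t/2` "we may consider the spacelike legs of our loop to
  be on the opposite side of the planes of reflection from the timelike legs and apply reflection
  positivity … Applying the Schwarz inequality for sums gives" a bound by the two-point function of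
  Polyakov loops): `⟨W_{(L/2)×w}⟩² ≤ Re ⟨tr ρ(Π₀(0)) · conj tr ρ(Π₀(w eⱼ))⟩`, where
  `Π₀(x) = lineHolonomy U 0 L x` is the Polyakov loop (closed straight line of `L` links) in the
  direction `0` through `x`. (With normalised traces this reads `W² ≤ N² G_w`; the factor `N²` is
  TY's "(∑ …)" = `4` for `SU(2)`.)
* `polyakovCorrelator_normSq_le_double` — **doubling for the Polyakov-loop two-point function**
  (TY App. I §B: "exactly the same procedure of successively applying various reflections … may be
  applied to the two point function (A1.5) to show that `(G_J)^{1/J}` is monotonically increasing"):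
  for the Polyakov loops `Πⱼ` in a spatial direction `j` at times `0` and `s ≤ L/2`,
  `|⟨tr ρ(Πⱼ(0)) conj tr ρ(Πⱼ(s e₀))⟩|² ≤ N² · Re ⟨tr ρ(Πⱼ(0)) conj tr ρ(Πⱼ(2s e₀))⟩`, the right side
  being `≥ 0`.
* `polyakovCorrelator_swap` — the coordinate swap `0 ↔ j` (`wilsonExpectation_comp_configPerm`)
  turns the correlator of direction-`0` Polyakov loops separated along `j` into the correlator of
  direction-`j` Polyakov loops separated along `0`, so that the two halves of the chain, which use
  reflections in two different directions in the source, can both be run with the tree's time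
  reflection.

The last link of the chain — the bound of the Polyakov-loop correlator at separation `L/2` by
't Hooft's twisted partition function (TY (A1.8)) — and the assembled inequalities (TY (A1.9),
(2.10)) are in `TomboulisYaffeInequality.lean`. All statements here are proved; there are no
definitions.

## References

* E. T. Tomboulis, L. G. Yaffe, Comm. Math. Phys. 100 (1985) 313–341, §II (2.4)–(2.7), Appendix I
  (A1.1)–(A1.7). [TomboulisYaffe1985]
* E. Seiler, LNP 159 (1982) §2; K. Osterwalder, E. Seiler, Ann. Phys. 110 (1978) 440, §2.
-/

open MeasureTheory Finset Complex
open scoped ComplexOrder ComplexConjugate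

namespace Literature.MathematicalPhysics.QuantumFieldTheory

noncomputable section

namespace TomboulisYaffe

open WilsonRP WilsonSiteRP Literature.RepresentationTheory.CompactGroups

variable {d L N : ℕ} [NeZero d] [NeZero L] {G : Type*} [Group G] [TopologicalSpace G]
  [IsTopologicalGroup G] [CompactSpace G] [MeasurableSpace G] [BorelSpace G]
  (ρ : G →* Matrix (Fin N) (Fin N) ℂ)

/-! ## Plumbing: traces, lines, coordinates -/

section Plumbing

omit [NeZero d] [NeZero L] [MeasurableSpace G] [BorelSpace G] in
/-- `‖tr ρ(g)‖ ≤ N` for a continuous `N`-dimensional representation of a compact group. [folklore] -/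
private theorem norm_trace_le (hρ : Continuous ρ) (g : G) : ‖(ρ g).trace‖ ≤ N := by
  rw [← CompactGroup.trace_unitarize ρ hρ, Matrix.trace]
  refine (norm_sum_le _ _).trans ?_
  calc ∑ k, ‖Matrix.diag (CompactGroup.unitarize ρ hρ g) k‖ ≤ ∑ _k : Fin N, (1 : ℝ) :=
        Finset.sum_le_sum fun k _ => CompactGroup.norm_unitarize_apply_le_one ρ hρ g k k
    _ = N := by simp

omit [NeZero d] [NeZero L] [MeasurableSpace G] [BorelSpace G] in
/-- Rows of the unitarised representation are orthonormal: `∑_{i,l} σ(g)_{il} conj σ(g)_{il} = N`.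
[folklore] -/
private theorem sum_unitarize_mul_conj_self (hρ : Continuous ρ) (g : G) :
    ∑ i, ∑ l, CompactGroup.unitarize ρ hρ g i l * conj (CompactGroup.unitarize ρ hρ g i l) = N := by
  rw [← WilsonLoopRP.trace_unitarize_mul_inv ρ hρ g g, mul_inv_cancel, map_one, Matrix.trace_one,
    Fintype.card_fin]

omit [NeZero d] [NeZero L] in
/-- The value `n < L` of the residue `n`. [folklore] -/
private theorem val_natCast_of_lt {n : ℕ} (hn : n < L) : ((n : ℕ) : ZMod L).val = n := by
  rw [ZMod.val_natCast, Nat.mod_eq_of_lt hn]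

omit [NeZero L] in
/-- Time coordinate of `x + s eⱼ` (`j ≠ 0`). [folklore] -/
private theorem apply_zero_add_single_of_ne' (x : Site d L) {j : Fin d} (hj : j ≠ 0) (s : ZMod L) :
    (x + Pi.single j s : Site d L) 0 = x 0 := by
  simp [Pi.single_eq_of_ne hj.symm]

omit [NeZero L] in
/-- A site whose time coordinate `c` satisfies `c + c = 0` is fixed by `θ'`. [folklore] -/
private theorem negReflect_add_single_zero_of_two_mul (x : Site d L) (hx : x 0 = 0) {c : ZMod L}
    (hc : c + c = 0) : (x + Pi.single 0 c : Site d L).negReflect = x + Pi.single 0 c :=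
  negReflect_of_two_mul (by simp [hx, hc])

omit [NeZero L] in
/-- `θ'(x + c e₀) = x - c e₀` for `x` in the time slice `0`. [folklore] -/
private theorem negReflect_add_single_zero (x : Site d L) (hx : x 0 = 0) (c : ZMod L) :
    (x + Pi.single 0 c : Site d L).negReflect = x + Pi.single 0 (-c) := by
  funext k
  by_cases hk : k = 0
  · subst hk; simp [hx]
  · simp [negReflect_apply_of_ne _ hk, hk]

end Plumbing

/-! ## Doubling of Wilson loops in the time direction (TY (A1.3)) -/

section Doubling

/-- **Doubling a Wilson loop across a reflection plane** (Tomboulis–Yaffe 1985 App. I (A1.3):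
`W_{1,1} ≤ W_{1,2}^{1/2}` and its iterates, from reflection positivity in the lattice hyperplane
containing one side of the loop): on the even torus, for any real `β`, a spatial direction `j ≠ 0`
and `h ≤ L/2`, the rectangular loops at the origin with `h` resp. `2h` steps in the time direction
`0` and `w` steps in direction `j` satisfy `0 ≤ ⟨W_{2h×w}⟩` and `⟨W_{h×w}⟩² ≤ ⟨W_{2h×w}⟩` (the `2×2`
Gram matrix `[⟨W_{(a+b)×w}⟩]_{a,b ∈ {0,h}}` of the tree's `gram_wilsonLoop_nonneg_even` is positive
semidefinite and `W_{0×w} = 1`). [cite: TomboulisYaffe1985, App. I (A1.3)] -/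
theorem wilsonLoop_sq_le_double (hL : Even L) (hρ : Continuous ρ) (β : ℝ) {j : Fin d} (hj : j ≠ 0)
    (h w : ℕ) (hh : h ≤ L / 2) :
    0 ≤ wilsonExpectation ρ β (wilsonLoop ρ (0 : Site d L) 0 j (2 * h) w) ∧
    (wilsonExpectation ρ β (wilsonLoop ρ (0 : Site d L) 0 j h w)) ^ 2 ≤
      wilsonExpectation ρ β (wilsonLoop ρ (0 : Site d L) 0 j (2 * h) w) := by
  -- `0 ≤ W(2h)`: the Gram sum over `S = {h}`
  have hnn : 0 ≤ wilsonExpectation ρ β (wilsonLoop ρ (0 : Site d L) 0 j (2 * h) w) := by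
    have hg := gram_wilsonLoop_nonneg_even ρ hL hρ β hj w {h} (by simpa using hh) (fun _ => 1)
    simpa [two_mul] using hg
  refine ⟨hnn, ?_⟩
  rcases Nat.eq_zero_or_pos N with hN | hN
  · subst hN
    simp only [wilsonLoop, wilsonExpectation, Nat.cast_zero, inv_zero, zero_mul, integral_zero]
    simp
  haveI := isProbabilityMeasure_wilsonMeasure (d := d) (L := L) ρ hρ β
  -- the trivial loop `W_{0×w} = 1`
  have hW0 : wilsonExpectation ρ β (wilsonLoop ρ (0 : Site d L) 0 j 0 w) = 1 := by
    have hhol : ∀ U : GaugeConfig d L G, rectangleHolonomy U (0 : Site d L) 0 j 0 w = 1 := fun U => by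
      simp [rectangleHolonomy, lineHolonomy]
    have h0 : ∀ U : GaugeConfig d L G, wilsonLoop ρ (0 : Site d L) 0 j 0 w U = 1 := fun U => by
      rw [wilsonLoop, hhol, map_one, Matrix.trace_one, Fintype.card_fin]
      simp [hN.ne']
    simp only [h0, wilsonExpectation, integral_const, probReal_univ, one_smul]
  rcases Nat.eq_zero_or_pos h with rfl | hpos
  · -- `h = 0`: both loops are trivial
    rw [mul_zero, hW0]; norm_num
  -- `h ≠ 0`: the Gram sum over `S = {0, h}` with coefficients `(-W(h), 1)`
  set Wh := wilsonExpectation ρ β (wilsonLoop ρ (0 : Site d L) 0 j h w) with hWh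
  have h0h : (0 : ℕ) ≠ h := by omega
  have hg := gram_wilsonLoop_nonneg_even ρ hL hρ β hj w {0, h}
    (fun a ha => by
      simp only [Finset.mem_insert, Finset.mem_singleton] at ha
      rcases ha with rfl | rfl <;> omega)
    (fun a => if a = 0 then -Wh else 1)
  rw [Finset.sum_pair h0h, Finset.sum_pair h0h, Finset.sum_pair h0h] at hg
  simp only [↓reduceIte, if_neg (Ne.symm h0h), zero_add, add_zero, hW0] at hg
  rw [← two_mul, ← hWh] at hg
  nlinarith [hg]

end Doubling

/-! ## The loop of time extent `L/2`: removing the legs in the reflection planes (TY (A1.6)) -/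

section HalfLoop

/-- Trace of a product of four matrices as an iterated sum (grouped `(AB)(CD)`). [folklore] -/
private theorem trace_mul_mul_mul {n : Type*} [Fintype n] [DecidableEq n] (A B C D : Matrix n n ℂ) :
    (A * B * C * D).trace = ∑ a, ∑ c, ∑ b, ∑ e, (A a b * B b c) * (C c e * D e a) := by
  rw [Matrix.mul_assoc (A * B) C D, Matrix.trace]
  simp only [Matrix.diag_apply, Matrix.mul_apply, Finset.sum_mul_sum]

/-- **The Wilson loop of time extent `L/2` is bounded by the Polyakov-loop two-point function**
(Tomboulis–Yaffe 1985 App. I (A1.6): both spatial legs of the `(L_t/2) × J` loop lie in the two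
reflection planes; "we may consider the spacelike legs of our loop to be on the opposite side of the
planes of reflection from the timelike legs and apply reflection positivity … Applying the Schwarz
inequality for sums gives" the bound by `⟨∑ U_{ij}θ(U_{ij}) ∑ U'_{ij}θ(U'_{ij})⟩`, the two timelike
legs closing up with their reflections into two Polyakov loops). Torus form, any real `β`, compact
`G`, continuous `ρ`, `L` even: for the loop at the origin with `L/2` steps in the time direction `0`
and `w` steps in direction `j ≠ 0`,
`⟨W_{(L/2)×w}⟩² ≤ Re ⟨tr ρ(Π₀(0)) · conj tr ρ(Π₀(w eⱼ))⟩`, `Π₀(x) = lineHolonomy U 0 L x` the Polyakov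
loop through `x` in direction `0` (with normalised traces: `W² ≤ N² · G_w`).
[cite: TomboulisYaffe1985, App. I (A1.6)] -/
theorem wilsonLoop_half_sq_le_polyakovCorrelator (hL : Even L) (hρ : Continuous ρ) (β : ℝ)
    {j : Fin d} (hj : j ≠ 0) (w : ℕ) :
    (wilsonExpectation ρ β (wilsonLoop ρ (0 : Site d L) 0 j (L / 2) w)) ^ 2 ≤
      (wilsonExpectation ρ β fun U : GaugeConfig d L G =>
        (ρ (lineHolonomy U 0 L 0)).trace *
          conj ((ρ (lineHolonomy U 0 L ((0 : Site d L) + Pi.single j (w : ZMod L)))).trace)).re := by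
  haveI : Fact (1 < L) := ⟨by obtain ⟨r, hr⟩ := hL; have := NeZero.ne L; omega⟩
  haveI := isProbabilityMeasure_wilsonMeasure (d := d) (L := L) ρ hρ β
  rcases Nat.eq_zero_or_pos N with hN | hN
  · subst hN
    simp [wilsonLoop, wilsonExpectation]
  obtain ⟨r, hr⟩ := hL
  set m : ℕ := L / 2 with hm_def
  have hmr : m = r := by omega
  have hmL : m + m = L := by omega
  have hmlt : m < L := by have := NeZero.ne L; omega
  have hmm : ((m : ℕ) : ZMod L) + (m : ℕ) = 0 := by
    rw [← Nat.cast_add, hmL, ZMod.natCast_self]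
  set σ := CompactGroup.unitarize ρ hρ with hσ_def
  have hσc : Continuous σ := CompactGroup.continuous_unitarize ρ hρ
  -- the sites and the four legs
  set xm : Site d L := (0 : Site d L) + Pi.single 0 ((m : ℕ) : ZMod L) with hxm
  set xw : Site d L := (0 : Site d L) + Pi.single j ((w : ℕ) : ZMod L) with hxw
  have hxm0 : xm.negReflect = xm := negReflect_add_single_zero_of_two_mul 0 rfl hmm
  have hx00 : (0 : Site d L).negReflect = 0 := negReflect_of_two_mul (by simp)
  have hxw0 : xw 0 = 0 := by rw [hxw, apply_zero_add_single_of_ne' _ hj]; rfl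
  -- Polyakov loops from the reflected time-like legs
  have hu : ∀ U : GaugeConfig d L G,
      lineHolonomy U 0 m 0 * (lineHolonomy U.negReflect 0 m 0)⁻¹ = lineHolonomy U 0 L 0 := by
    intro U
    rw [WilsonLoopRP.lineHolonomy_negReflect_zero, inv_inv, ← hxm, hxm0, hxm,
      ← WilsonLoopRP.lineHolonomy_add U 0 m m 0, hmL]
  have hu' : ∀ U : GaugeConfig d L G,
      lineHolonomy U.negReflect 0 m xw * (lineHolonomy U 0 m xw)⁻¹ = (lineHolonomy U 0 L xw)⁻¹ := by
    intro U
    rw [WilsonLoopRP.lineHolonomy_negReflect_zero,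
      negReflect_add_single_zero_of_two_mul xw hxw0 hmm, ← mul_inv_rev,
      ← WilsonLoopRP.lineHolonomy_add U 0 m m xw, hmL]
  -- the two families
  set Φ : (Fin N × Fin N) × (Fin N × Fin N) → GaugeConfig d L G → ℂ :=
    fun k U => conj (σ (lineHolonomy U j w xm) k.2.1 k.1.2) * σ (lineHolonomy U j w 0) k.1.1 k.2.2
    with hΦ
  set Ψ : (Fin N × Fin N) × (Fin N × Fin N) → GaugeConfig d L G → ℂ :=
    fun k U => σ (lineHolonomy U 0 m 0) k.1.1 k.2.1 * conj (σ (lineHolonomy U 0 m xw) k.2.2 k.1.2)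
    with hΨ
  -- reflection invariance of the spatial legs
  have hgθ : ∀ U : GaugeConfig d L G, lineHolonomy U.negReflect j w 0 = lineHolonomy U j w 0 :=
    fun U => by rw [WilsonLoopRP.lineHolonomy_negReflect_of_ne U hj, hx00]
  have hg'θ : ∀ U : GaugeConfig d L G, lineHolonomy U.negReflect j w xm = lineHolonomy U j w xm :=
    fun U => by rw [WilsonLoopRP.lineHolonomy_negReflect_of_ne U hj, hxm0]
  have hΦθ : ∀ k U, Φ k (GaugeConfig.negReflect U) = Φ k U := fun k U => by
    simp only [hΦ, hgθ, hg'θ]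
  -- admissibility
  have hE : ∀ e : Edge d L, IsSitePosEdge e ∨ IsSharedEdge e →
      e ∈ ((sitePosEdges ∪ sharedEdges : Finset (Edge d L)) : Set (Edge d L)) := fun e he => by
    rw [Finset.coe_union, Set.mem_union, Finset.mem_coe, Finset.mem_coe, mem_sitePosEdges,
      mem_sharedEdges]
    exact he
  have dep_time : ∀ (x : Site d L), x 0 = 0 → DependsOn (fun U : GaugeConfig d L G => lineHolonomy U 0 m x)
      ((sitePosEdges ∪ sharedEdges : Finset (Edge d L)) : Set (Edge d L)) := by
    intro x hx U V hUV
    refine WilsonLoopRP.lineHolonomy_congr 0 m x fun s hs => hUV _ (hE _ (Or.inl ?_))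
    unfold IsSitePosEdge
    dsimp only
    simp only [↓reduceIte, Pi.add_apply, hx, Pi.single_eq_same, zero_add]
    rw [val_natCast_of_lt (by omega)]
    omega
  have dep_space : ∀ (x : Site d L), (x 0 = 0 ∨ x 0 = ((m : ℕ) : ZMod L)) →
      DependsOn (fun U : GaugeConfig d L G => lineHolonomy U j w x)
      ((sitePosEdges ∪ sharedEdges : Finset (Edge d L)) : Set (Edge d L)) := by
    intro x hx U V hUV
    refine WilsonLoopRP.lineHolonomy_congr j w x fun s hs => hUV _ (hE _ (Or.inr ?_))
    refine ⟨hj, ?_⟩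
    dsimp only
    rw [apply_zero_add_single_of_ne' _ hj]
    rcases hx with hx | hx
    · left; rw [hx, ZMod.val_zero]
    · right; rw [hx, val_natCast_of_lt hmlt]
  have hΦobs : ∀ k, IsHalfObs (Φ k) := fun k => by
    refine ⟨?_, ⟨1, fun U => ?_⟩, fun U V hUV => ?_⟩
    · exact (Complex.continuous_conj.measurable.comp
        (WilsonLoopRP.entryMeasurable_lineHolonomy hσc j w xm _ _)).mul
        (WilsonLoopRP.entryMeasurable_lineHolonomy hσc j w 0 _ _)
    · rw [hΦ, norm_mul, Complex.norm_conj]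
      exact mul_le_one₀ (CompactGroup.norm_unitarize_apply_le_one ρ hρ _ _ _) (norm_nonneg _)
        (CompactGroup.norm_unitarize_apply_le_one ρ hρ _ _ _)
    · simp only [hΦ, dep_space xm (Or.inr (by simp [hxm])) hUV, dep_space (0 : Site d L) (Or.inl rfl) hUV]
  have hΨobs : ∀ k, IsHalfObs (Ψ k) := fun k => by
    refine ⟨?_, ⟨1, fun U => ?_⟩, fun U V hUV => ?_⟩
    · exact (WilsonLoopRP.entryMeasurable_lineHolonomy hσc 0 m 0 _ _).mul
        (Complex.continuous_conj.measurable.comp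
          (WilsonLoopRP.entryMeasurable_lineHolonomy hσc 0 m xw _ _))
    · rw [hΨ, norm_mul, Complex.norm_conj]
      exact mul_le_one₀ (CompactGroup.norm_unitarize_apply_le_one ρ hρ _ _ _) (norm_nonneg _)
        (CompactGroup.norm_unitarize_apply_le_one ρ hρ _ _ _)
    · simp only [hΨ, dep_time (0 : Site d L) rfl hUV, dep_time xw hxw0 hUV]
  -- (1) the cross term is the loop
  have hcross_pt : ∀ U : GaugeConfig d L G,
      ∑ k, conj (Φ k U.negReflect) * Ψ k U = (ρ (rectangleHolonomy U 0 0 j m w)).trace := by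
    intro U
    have hrect : rectangleHolonomy U 0 0 j m w =
        lineHolonomy U 0 m 0 * lineHolonomy U j w xm * (lineHolonomy U 0 m xw)⁻¹ *
          (lineHolonomy U j w 0)⁻¹ := rfl
    rw [hrect, ← CompactGroup.trace_unitarize ρ hρ, map_mul, map_mul, map_mul,
      CompactGroup.unitarize_inv, CompactGroup.unitarize_inv, trace_mul_mul_mul,
      Fintype.sum_prod_type]
    simp only [Fintype.sum_prod_type, hΦθ]
    refine Finset.sum_congr rfl fun a _ => Finset.sum_congr rfl fun c _ =>
      Finset.sum_congr rfl fun b _ => Finset.sum_congr rfl fun e _ => ?_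
    simp only [hΦ, hΨ, map_mul, Complex.conj_conj, Matrix.star_apply, Complex.star_def, hσ_def]
    ring
  have hcross : siteRPForm ρ β Φ Ψ =
      ∫ U : GaugeConfig d L G, (ρ (rectangleHolonomy U (0 : Site d L) 0 j m w)).trace
        ∂(wilsonMeasure ρ β) := by
    unfold siteRPForm
    rw [← integral_finsetSum _ fun k _ => integrable_conj_negReflect_mul ρ hρ β (hΦobs k) (hΨobs k)]
    exact integral_congr_ae (ae_of_all _ hcross_pt)
  have hcross_re : (siteRPForm ρ β Φ Ψ).re =
      N * wilsonExpectation ρ β (wilsonLoop ρ (0 : Site d L) 0 j m w) := by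
    rw [hcross]
    have hint : Integrable (fun U : GaugeConfig d L G => (ρ (rectangleHolonomy U 0 0 j m w)).trace)
        (wilsonMeasure ρ β) := by
      refine Integrable.of_bound ?_ N (ae_of_all _ fun U => norm_trace_le ρ hρ _)
      rw [show (fun U : GaugeConfig d L G => (ρ (rectangleHolonomy U 0 0 j m w)).trace) =
          fun U => (σ (rectangleHolonomy U 0 0 j m w)).trace by
        funext U; rw [hσ_def, CompactGroup.trace_unitarize]]
      exact (WilsonLoopRP.entryMeasurable_rectangleHolonomy ρ hρ _ _ _ _ _).measurable_trace.aestronglyMeasurable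
    have := integral_re hint
    simp only [RCLike.re_to_complex] at this
    rw [← this]
    unfold wilsonExpectation
    rw [← integral_const_mul]
    refine integral_congr_ae (ae_of_all _ fun U => ?_)
    exact WilsonLoopRP.re_trace_eq_mul_wilsonLoop ρ hN.ne' _ _ _ _ _ _
  -- (2) the `Φ` Gram entry is `N²`
  have hΦΦ_pt : ∀ U : GaugeConfig d L G, ∑ k, conj (Φ k U.negReflect) * Φ k U = (N : ℂ) * N := by
    intro U
    -- abbreviations for the two legs
    set B := σ (lineHolonomy U j w xm) with hB
    set D := σ (lineHolonomy U j w 0) with hD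
    have hP : ∑ c, ∑ b, B b c * conj (B b c) = N := by
      rw [Finset.sum_comm]; exact sum_unitarize_mul_conj_self ρ hρ _
    have hQ : ∑ a, ∑ e, D a e * conj (D a e) = N := sum_unitarize_mul_conj_self ρ hρ _
    simp only [hΦθ, Fintype.sum_prod_type]
    calc ∑ a, ∑ c, ∑ b, ∑ e, conj (Φ ((a, c), (b, e)) U) * Φ ((a, c), (b, e)) U
        = ∑ a, ∑ c, ∑ b, ∑ e, (B b c * conj (B b c)) * (D a e * conj (D a e)) := by
          refine Finset.sum_congr rfl fun a _ => Finset.sum_congr rfl fun c _ =>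
            Finset.sum_congr rfl fun b _ => Finset.sum_congr rfl fun e _ => ?_
          simp only [hΦ, hB, hD, map_mul, Complex.conj_conj]
          ring
      _ = ∑ a, (∑ c, ∑ b, B b c * conj (B b c)) * ∑ e, D a e * conj (D a e) := by
          simp only [Finset.sum_mul]; simp only [Finset.mul_sum]
      _ = (N : ℂ) * N := by rw [hP, ← Finset.mul_sum, hQ]
  have hΦΦ : (siteRPForm ρ β Φ Φ).re = (N : ℝ) * N := by
    unfold siteRPForm
    rw [← integral_finsetSum _ fun k _ => integrable_conj_negReflect_mul ρ hρ β (hΦobs k) (hΦobs k),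
      integral_congr_ae (ae_of_all _ hΦΦ_pt), integral_const, probReal_univ, one_smul]
    norm_cast
  -- (3) the `Ψ` Gram entry is the Polyakov-loop correlator
  have hΨΨ_pt : ∀ U : GaugeConfig d L G, ∑ k, conj (Ψ k U.negReflect) * Ψ k U =
      (ρ (lineHolonomy U 0 L 0)).trace * conj ((ρ (lineHolonomy U 0 L xw)).trace) := by
    intro U
    have h1 : (ρ (lineHolonomy U 0 L 0)).trace =
        ∑ a, ∑ b, σ (lineHolonomy U 0 m 0) a b * conj (σ (lineHolonomy U.negReflect 0 m 0) a b) := by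
      rw [← hu U, ← CompactGroup.trace_unitarize ρ hρ, hσ_def, WilsonLoopRP.trace_unitarize_mul_inv]
    have h2 : conj ((ρ (lineHolonomy U 0 L xw)).trace) =
        ∑ e, ∑ c, σ (lineHolonomy U.negReflect 0 m xw) e c * conj (σ (lineHolonomy U 0 m xw) e c) := by
      rw [← CompactGroup.trace_map_inv ρ hρ, ← hu' U, ← CompactGroup.trace_unitarize ρ hρ, hσ_def,
        WilsonLoopRP.trace_unitarize_mul_inv]
    rw [h1, h2]
    set A := σ (lineHolonomy U 0 m 0) with hA
    set A' := σ (lineHolonomy U.negReflect 0 m 0) with hA'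
    set C := σ (lineHolonomy U 0 m xw) with hC
    set C' := σ (lineHolonomy U.negReflect 0 m xw) with hC'
    simp only [Fintype.sum_prod_type]
    calc ∑ a, ∑ c, ∑ b, ∑ e, conj (Ψ ((a, c), (b, e)) U.negReflect) * Ψ ((a, c), (b, e)) U
        = ∑ a, ∑ c, ∑ b, ∑ e, (A a b * conj (A' a b)) * (C' e c * conj (C e c)) := by
          refine Finset.sum_congr rfl fun a _ => Finset.sum_congr rfl fun c _ =>
            Finset.sum_congr rfl fun b _ => Finset.sum_congr rfl fun e _ => ?_
          simp only [hΨ, hA, hA', hC, hC', map_mul, Complex.conj_conj]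
          ring
      _ = ∑ a, ∑ b, ∑ e, ∑ c, (A a b * conj (A' a b)) * (C' e c * conj (C e c)) := by
          refine Finset.sum_congr rfl fun a _ => ?_
          rw [Finset.sum_comm]
          exact Finset.sum_congr rfl fun b _ => Finset.sum_comm
      _ = (∑ a, ∑ b, A a b * conj (A' a b)) * ∑ e, ∑ c, C' e c * conj (C e c) := by
          simp only [Finset.sum_mul]; simp only [Finset.mul_sum]
  have hΨΨ : siteRPForm ρ β Ψ Ψ = wilsonExpectation ρ β (fun U : GaugeConfig d L G =>
      (ρ (lineHolonomy U 0 L 0)).trace * conj ((ρ (lineHolonomy U 0 L xw)).trace)) := by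
    unfold siteRPForm wilsonExpectation
    rw [← integral_finsetSum _ fun k _ => integrable_conj_negReflect_mul ρ hρ β (hΨobs k) (hΨobs k)]
    exact integral_congr_ae (ae_of_all _ hΨΨ_pt)
  -- (4) Cauchy–Schwarz
  have hCS := normSq_siteRPForm_le ρ ⟨r, hr⟩ hρ β hΦobs hΨobs
  rw [hΦΦ, hΨΨ] at hCS
  have hre : (siteRPForm ρ β Φ Ψ).re ^ 2 ≤ ‖siteRPForm ρ β Φ Ψ‖ ^ 2 :=
    sq_le_sq.2 (by rw [abs_norm]; exact Complex.abs_re_le_norm _)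
  rw [hcross_re] at hre
  have hN2 : (0 : ℝ) < (N : ℝ) * N := by positivity
  have key := hre.trans hCS
  rw [mul_pow] at key
  have : (wilsonExpectation ρ β (wilsonLoop ρ (0 : Site d L) 0 j m w)) ^ 2 ≤
      (wilsonExpectation ρ β fun U : GaugeConfig d L G =>
        (ρ (lineHolonomy U 0 L 0)).trace * conj ((ρ (lineHolonomy U 0 L xw)).trace)).re := by
    have h' : (N : ℝ) ^ 2 = (N : ℝ) * N := sq _
    rw [h'] at key
    exact le_of_mul_le_mul_left (by linarith [key]) hN2
  exact this

end HalfLoop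

/-! ## Doubling for the Polyakov-loop two-point function (TY App. I §B) -/

section PolyakovDoubling

/-- **Doubling the separation of two Polyakov loops** (Tomboulis–Yaffe 1985 App. I §B: "exactly
the same procedure of successively applying various reflections that was used for Wilson loops may
be applied to the two point function (A1.5) to show that `(G_J)^{1/J}` is monotonically increasing in
`J` (for `1 ≤ J ≤ L/2`)"; here the reflection in the lattice hyperplane containing one of the two
loops). Torus form, any real `β`, `L` even: for the Polyakov loops `Πⱼ(x) = lineHolonomy U j L x`
winding in a spatial direction `j ≠ 0`, at the origin and at time `s ≤ L/2`,
`0 ≤ Re ⟨tr ρ(Πⱼ(0)) conj tr ρ(Πⱼ(2s e₀))⟩` and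
`|⟨tr ρ(Πⱼ(0)) conj tr ρ(Πⱼ(s e₀))⟩|² ≤ N² · Re ⟨tr ρ(Πⱼ(0)) conj tr ρ(Πⱼ(2s e₀))⟩`
(with normalised traces, `G_s² ≤ G_0 G_{2s} ≤ G_{2s}`). [cite: TomboulisYaffe1985, App. I §B (A1.5)] -/
theorem polyakovCorrelator_normSq_le_double (hL : Even L) (hρ : Continuous ρ) (β : ℝ)
    {j : Fin d} (hj : j ≠ 0) (s : ℕ) (hs : s ≤ L / 2) :
    0 ≤ (wilsonExpectation ρ β fun U : GaugeConfig d L G =>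
        (ρ (lineHolonomy U j L 0)).trace *
          conj ((ρ (lineHolonomy U j L ((0 : Site d L) + Pi.single 0 (((2 * s : ℕ)) : ZMod L)))).trace)).re ∧
    ‖wilsonExpectation ρ β fun U : GaugeConfig d L G =>
        (ρ (lineHolonomy U j L 0)).trace *
          conj ((ρ (lineHolonomy U j L ((0 : Site d L) + Pi.single 0 ((s : ℕ) : ZMod L)))).trace)‖ ^ 2 ≤
      (N : ℝ) ^ 2 * (wilsonExpectation ρ β fun U : GaugeConfig d L G =>
        (ρ (lineHolonomy U j L 0)).trace *
          conj ((ρ (lineHolonomy U j L ((0 : Site d L) + Pi.single 0 (((2 * s : ℕ)) : ZMod L)))).trace)).re := by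
  haveI : Fact (1 < L) := ⟨by obtain ⟨r, hr⟩ := hL; have := NeZero.ne L; omega⟩
  haveI := isProbabilityMeasure_wilsonMeasure (d := d) (L := L) ρ hρ β
  have hsL : s < L := by obtain ⟨r, hr⟩ := hL; have := NeZero.ne L; omega
  set xs : Site d L := (0 : Site d L) + Pi.single 0 ((s : ℕ) : ZMod L) with hxs
  set x2s : Site d L := (0 : Site d L) + Pi.single 0 (((2 * s : ℕ)) : ZMod L) with hx2s
  have hx00 : (0 : Site d L).negReflect = 0 := negReflect_of_two_mul (by simp)
  have hxsθ : xs.negReflect = (0 : Site d L) + Pi.single 0 (-((s : ℕ) : ZMod L)) :=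
    negReflect_add_single_zero 0 rfl _
  -- the two one-member families
  set F₁ : Unit → GaugeConfig d L G → ℂ := fun _ U => conj ((ρ (lineHolonomy U j L 0)).trace) with hF₁
  set F₂ : Unit → GaugeConfig d L G → ℂ := fun _ U => conj ((ρ (lineHolonomy U j L xs)).trace) with hF₂
  have hE : ∀ e : Edge d L, IsSitePosEdge e ∨ IsSharedEdge e →
      e ∈ ((sitePosEdges ∪ sharedEdges : Finset (Edge d L)) : Set (Edge d L)) := fun e he => by
    rw [Finset.coe_union, Set.mem_union, Finset.mem_coe, Finset.mem_coe, mem_sitePosEdges,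
      mem_sharedEdges]
    exact he
  have dep_space : ∀ (x : Site d L), (x 0).val ≤ L / 2 →
      DependsOn (fun U : GaugeConfig d L G => lineHolonomy U j L x)
      ((sitePosEdges ∪ sharedEdges : Finset (Edge d L)) : Set (Edge d L)) := by
    intro x hx U V hUV
    refine WilsonLoopRP.lineHolonomy_congr j L x fun s' _ => hUV _ (hE _ ?_)
    unfold IsSitePosEdge IsSharedEdge
    simp only [hj, ↓reduceIte, ne_eq, not_false_eq_true, true_and]
    rw [apply_zero_add_single_of_ne' _ hj]
    omega
  have hobs : ∀ (x : Site d L), (x 0).val ≤ L / 2 →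
      IsHalfObs (fun U : GaugeConfig d L G => conj ((ρ (lineHolonomy U j L x)).trace)) := by
    intro x hx
    refine ⟨Complex.continuous_conj.measurable.comp
      (WilsonLoopRP.entryMeasurable_lineHolonomy hρ j L x).measurable_trace, ⟨N, fun U => ?_⟩,
      fun U V hUV => ?_⟩
    · rw [Complex.norm_conj]; exact norm_trace_le ρ hρ _
    · simp only [dep_space x hx hUV]
  have h1 : ∀ k, IsHalfObs (F₁ k) := fun _ => hobs (0 : Site d L) (by simp)
  have h2 : ∀ k, IsHalfObs (F₂ k) := fun _ => hobs xs (by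
    rw [hxs]; simp only [Pi.add_apply, Pi.zero_apply, Pi.single_eq_same, zero_add]
    rw [val_natCast_of_lt hsL]; exact hs)
  -- the three Gram entries
  have h12 : siteRPForm ρ β F₁ F₂ = wilsonExpectation ρ β (fun U : GaugeConfig d L G =>
      (ρ (lineHolonomy U j L 0)).trace * conj ((ρ (lineHolonomy U j L xs)).trace)) := by
    unfold siteRPForm wilsonExpectation
    rw [Fintype.sum_unique]
    refine integral_congr_ae (ae_of_all _ fun U => ?_)
    simp only [hF₁, hF₂, Complex.conj_conj, WilsonLoopRP.lineHolonomy_negReflect_of_ne U hj, hx00]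
  have h11 : (siteRPForm ρ β F₁ F₁).re ≤ (N : ℝ) ^ 2 := by
    unfold siteRPForm
    rw [Fintype.sum_unique]
    have hb : ∀ U : GaugeConfig d L G, ‖conj (F₁ () U.negReflect) * F₁ () U‖ ≤ (N : ℝ) ^ 2 := fun U => by
      rw [norm_mul, Complex.norm_conj, hF₁, Complex.norm_conj, Complex.norm_conj, sq]
      exact mul_le_mul (norm_trace_le ρ hρ _) (norm_trace_le ρ hρ _) (norm_nonneg _) (Nat.cast_nonneg _)
    refine (Complex.re_le_norm _).trans ((norm_integral_le_of_norm_le_const (ae_of_all _ hb)).trans ?_)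
    rw [probReal_univ, mul_one]
  have h22 : siteRPForm ρ β F₂ F₂ = wilsonExpectation ρ β (fun U : GaugeConfig d L G =>
      (ρ (lineHolonomy U j L 0)).trace * conj ((ρ (lineHolonomy U j L x2s)).trace)) := by
    unfold siteRPForm
    rw [Fintype.sum_unique, ← wilsonExpectation_comp_torusConfigShift ρ β xs]
    unfold wilsonExpectation
    have hA : (0 : Site d L) + Pi.single 0 (-((s : ℕ) : ZMod L)) = 0 - xs := by
      rw [hxs]; simp [Pi.single_neg]
    have hB : x2s - xs = xs := by
      rw [hx2s, hxs, zero_add, zero_add, ← Pi.single_sub]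
      congr 1
      push_cast
      ring
    refine integral_congr_ae (ae_of_all _ fun U => ?_)
    simp only [hF₂, Complex.conj_conj, WilsonLoopRP.lineHolonomy_negReflect_of_ne U hj, hxsθ,
      Function.comp_apply, WilsonLoopRP.lineHolonomy_torusConfigShift, hA, hB]
  have hpos := siteRPForm_self_nonneg ρ hL hρ β h2
  have hCS := normSq_siteRPForm_le ρ hL hρ β h1 h2
  rw [h12] at hCS
  rw [h22] at hCS hpos
  refine ⟨(Complex.nonneg_iff.1 hpos).1, hCS.trans ?_⟩
  exact mul_le_mul_of_nonneg_right h11 (Complex.nonneg_iff.1 hpos).1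

end PolyakovDoubling

/-! ## Swapping the axes -/

section Swap

omit [NeZero d] [NeZero L] [TopologicalSpace G] [IsTopologicalGroup G] [CompactSpace G]
  [BorelSpace G] in
/-- Straight lines of the axis-permuted configuration. [folklore] -/
private theorem lineHolonomy_configPerm (π : Equiv.Perm (Fin d)) (U : GaugeConfig d L G) (k : Fin d) :
    ∀ (n : ℕ) (y : Site d L),
      lineHolonomy (configPerm π U) k n y = lineHolonomy U (π.symm k) n (sitePerm π.symm y)
  | 0, y => by simp [lineHolonomy]
  | n + 1, y => by
    rw [lineHolonomy, lineHolonomy, lineHolonomy_configPerm π U k n, configPerm_apply, sitePerm_shift]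

/-- **Polyakov-loop correlators under the exchange of two axes** (coordinate-permutation symmetry
of the torus Wilson state, `wilsonExpectation_comp_configPerm`): the correlator of two Polyakov
loops in the time direction `0` separated by `w` steps in a spatial direction `j` equals the
correlator of two Polyakov loops in direction `j` separated by `w` steps in time. This lets both
halves of the Tomboulis–Yaffe chain (App. I §A–§B use reflections in time-like hyperplanes, §C in
space-like ones) be carried out with the tree's time reflection. [cite: TomboulisYaffe1985, App. I §B–§C] -/
theorem polyakovCorrelator_swap (hρ : Continuous ρ) (β : ℝ) (j : Fin d) (w : ℕ) :
    wilsonExpectation ρ β (fun U : GaugeConfig d L G =>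
        (ρ (lineHolonomy U 0 L 0)).trace *
          conj ((ρ (lineHolonomy U 0 L ((0 : Site d L) + Pi.single j (w : ZMod L)))).trace)) =
      wilsonExpectation ρ β (fun U : GaugeConfig d L G =>
        (ρ (lineHolonomy U j L 0)).trace *
          conj ((ρ (lineHolonomy U j L ((0 : Site d L) + Pi.single 0 (w : ZMod L)))).trace)) := by
  have h0 : sitePerm (Equiv.swap (0 : Fin d) j) (0 : Site d L) = 0 := by
    funext k; simp [sitePerm_apply]
  conv_rhs => rw [← wilsonExpectation_comp_configPerm ρ hρ β (Equiv.swap 0 j)]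
  congr 1
  funext U
  simp only [Function.comp_apply, lineHolonomy_configPerm, Equiv.symm_swap, Equiv.swap_apply_right,
    sitePerm_add, sitePerm_single, Equiv.swap_apply_left, h0]

end Swap

end TomboulisYaffe

end

end Literature.MathematicalPhysics.QuantumFieldTheory
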